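import Summits.AtomisticToContinuum.BoseEinsteinCondensation.Theses.BECInfDivCoherence
import Summits.AtomisticToContinuum.BoseEinsteinCondensation.Theorems.BECInfDivCoherenceGridInfDivCoherenceSignOfGroundStates
import Summits.AtomisticToContinuum.BoseEinsteinCondensation.Theorems.BECInfDivCoherenceGridInfDivCoherenceCoherencePosOfGroundStates
import Summits.AtomisticToContinuum.BoseEinsteinCondensation.Theorems.BECConjugateDominationHardCoreExtensionMaxFormApproximationFiniteRange
import HarnessLib

/-!
# Crux `GridInfDivCoherence` (stmt-AtomisticToContinuum-9114), line `registered`: the registered sign stub is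
# NECESSARY — `GridInfDivCoherence → stub_groundStateGridLevySign`, and the crux is EQUIVALENT to the sign stub
# given ground-state coherence positivity

The registered stub `stub_groundStateGridLevySign` (lead c4) is the exact ground-state form of the sign conjunct of
the crux: for every repulsive finite-range `v`, some `η > 0`, `ρ₀ > 0`, such that for `0 < ρ < ρ₀` and all large
`N`, every unit maximal-form ground state `f` on the torus of side `L = (N/ρ)^{1/3}` whose translation coherence
`G_f(r) = re⟪τ_{i, r/L} f, f⟫` is positive has all non-trivial discrete Lévy weights
`m⁻³ Σ_j log G_f((L/m)j) cos(2π q·j/m) ≥ 0`, `q ≢ 0`, `m = ⌊L/η⌋`.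

This file certifies that the stub is not stronger than the crux:

* `groundStateGridLevySign_of_gridInfDivCoherence : GridInfDivCoherence → Sign_gs`. Proof (namespace
  `GridLevySignNecessity`): take `η, ρ₀` from the crux and Ruelle finiteness
  (`exists_eventually_periodicGroundStateEnergy_lt_top`); at a large `N`, a unit ground state `f` is the `L²` limit
  of the free-embedded classes `ι₀Φ_k` of periodic trial states with `periodicEnergy v Φ_k ≤ E₀ + 1/(k+1)`
  (MaxFormApproximation for every repulsive finite-range profile, hard cores included —
  `stub_maxFormApproximationFiniteRange` of the sibling line, B. Simon's "maximal form = minimal form" in the Bose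
  sector); for `ε > 0` the crux's slack `δ` eventually exceeds `1/(k+1)`, so `ν̃_q(G_{Φ_k}) ≥ −ε`; the node
  coherences converge to `G_f > 0` at the nodes (`GridLevySignReduction.tendsto_re_cellCoherence`), so do the
  weights (`GridLevySignReduction.tendsto_logWeight`), whence `ν̃_q(G_f) ≥ −ε` for every `ε > 0`.
* `gridInfDivCoherence_iff_groundStateGridLevySign_of_pos`: under ground-state coherence positivity (every unit
  ground state has `re⟪τ_{i,u} f, f⟫ > 0` at every single-particle shift, dilute and eventually in `N` — the other
  registered residue of the line) the crux is EQUIVALENT to the sign stub (converse by the landed reductions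
  `stub_coherencePos_of_groundStates` p161669 and `stub_gridLevySign_of_groundStates` p162041).

References: Reed–Simon IV Thm XIII.64 [ReedSimonIV1978]; B. Simon, J. Operator Theory 1 (1979) 37–47; Mora–Castin
2003 §4.3 [MoraCastin2003].
-/

noncomputable section

namespace Summit.AtomisticToContinuum.BoseEinsteinCondensation.Theorems

open MeasureTheory Filter Literature.MathematicalPhysics.QuantumManyBody Literature.MathematicalPhysics.QuantumManyBody.BoseGas
  Literature.Analysis.FunctionSpaces
open Summit.AtomisticToContinuum.BoseEinsteinCondensation.Theses.BECInfDivCoherence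
open scoped ENNReal NNReal ComplexConjugate InnerProductSpace Topology

attribute [local instance] formDomain_measureSpace formDomain_isProbabilityMeasure
  formDomain_isProbabilityMeasure_pi comparison_isAddHaarMeasure comparison_isAddRightInvariant

namespace GridLevySignNecessity

open Summit.AtomisticToContinuum.BoseEinsteinCondensation.Cruxes.StaticResponseBound.UvThomsonForceWave
open Summit.AtomisticToContinuum.BoseEinsteinCondensation.Cruxes.HardCoreExtension.NearMinTower
  (stub_maxFormApproximationFiniteRange)

variable {N : ℕ} {L : ℝ} {v : ℝ → ℝ≥0∞}

/-- Local notation for the Hilbert space `L²((ℝ/ℤ)^{3N})`. -/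
local notation "L2T " N':max => Lp ℂ 2 (volume : Measure (UnitAddTorus (Fin N' × Fin 3)))

/-- Local notation: the translation `(τ_s g)(t) = g(t + s)` on `L²((ℝ/ℤ)^{3N})` (a linear isometry). -/
local notation "τ[" s "]" =>
  Lp.compMeasurePreservingₗᵢ ℂ (fun t => t + s) (measurePreserving_add_right volume s)

set_option quotPrecheck false in
/-- Local notation: the FREE embedding `ι₀Ψ ∈ L²((ℝ/ℤ)^{3N})` of a periodic trial state (auxiliary profile `0`). -/
local notation "ι₀[" hL "," Ψ "]" =>
  formEmbed hL measurable_zeroProfile (lintegral_periodicInteraction_zero_ne_top _ _)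
    ⟨graphEmbed hL measurable_zeroProfile (lintegral_periodicInteraction_zero_ne_top _ _)
      ⟨PeriodicTrialState.ψ Ψ, PeriodicTrialState.mem_periodicCore Ψ⟩, graphEmbed_mem_formDomain _ _ _ _⟩

/-- **Unit ground states are `L²` limits of near-minimising trial states** (every repulsive finite-range `v`, hard
cores included; `E₀ < ⊤`): for a unit `f` of the maximal-form ground-state class there are periodic trial states
`Φ_k` with `periodicEnergy v Φ_k ≤ E₀ + 1/(k+1)` whose free-embedded classes converge to `f` in `L²((ℝ/ℤ)^{3N})`
(MaxFormApproximation in the Bose sector, `stub_maxFormApproximationFiniteRange`, applied at accuracy `1/(k+1)` to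
`f`, whose maximal form is `≤ E₀`). [cite: ReedSimonIV1978, Thm XIII.64] -/
theorem exists_trialStates_tendsto_groundState (hv : IsRepulsiveFiniteRange v) (hL : 0 < L)
    (hE : periodicGroundStateEnergy v N L ≠ ⊤) {f : L2T N} (hf : f ∈ maxFormGroundStates v N L)
    (hf1 : ‖f‖ = 1) :
    ∃ Φ : ℕ → PeriodicTrialState N L,
      (∀ k, periodicEnergy v (Φ k) ≤ periodicGroundStateEnergy v N L + ENNReal.ofReal (1 / ((k : ℝ) + 1))) ∧
      Tendsto (fun k => (ι₀[hL, Φ k] : L2T N)) atTop (𝓝 f) := by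
  have hQle : maxForm v L f ≤ periodicGroundStateEnergy v N L := by
    have h := hf.2
    rwa [hf1, one_pow, ENNReal.ofReal_one, mul_one] at h
  have hQ : maxForm v L f ≠ ⊤ := ne_top_of_le_ne_top hE hQle
  have happrox : ∀ k : ℕ, ∃ Φ : PeriodicTrialState N L,
      periodicEnergy v Φ ≤ maxForm v L f + ENNReal.ofReal (1 / ((k : ℝ) + 1)) ∧
      ‖(ι₀[hL, Φ] : L2T N) - f‖ ≤ 1 / ((k : ℝ) + 1) := fun k =>
    stub_maxFormApproximationFiniteRange v hv N L hL f hf1 hf.1 hQ (1 / ((k : ℝ) + 1)) Nat.one_div_pos_of_nat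
  choose Φ hΦE hΦd using happrox
  refine ⟨Φ, fun k => (hΦE k).trans (add_le_add hQle le_rfl), ?_⟩
  rw [tendsto_iff_norm_sub_tendsto_zero]
  exact squeeze_zero (fun k => norm_nonneg _) hΦd tendsto_one_div_add_atTop_nhds_zero_nat

/-- **The sign of one weight of one ground state, fixed box.** At a box where the crux's conclusion holds for the
grid size `m` (for every `ε > 0` some `δ > 0` makes every `δ`-near-minimiser have `ν̃_q ≥ −ε` for all particles and
all non-trivial `q`) and `E₀ < ⊤`: a unit ground state `f` with positive translation coherence at particle `i` has
`ν̃_q(G_f) ≥ 0` for every non-trivial `q` (near-minimising trial states converging to `f`; the weights converge).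
[cite: ReedSimonIV1978, Thm XIII.64] -/
theorem logWeight_nonneg_of_slack (hv : IsRepulsiveFiniteRange v) (hL : 0 < L)
    (hE : periodicGroundStateEnergy v N L ≠ ⊤) (m : ℕ)
    (hcrux : ∀ ε : ℝ, 0 < ε → ∃ δ : ℝ≥0∞, 0 < δ ∧ ∀ Ψ : PeriodicTrialState N L,
      periodicEnergy v Ψ ≤ periodicGroundStateEnergy v N L + δ → ∀ (i : Fin N) (q : Fin 3 → Fin m),
        (∃ k, (q k : ℕ) ≠ 0) →
        -ε ≤ (∑ j : Fin 3 → Fin m,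
          Real.log ((∫ X in cellN N L, conj (Ψ.ψ (Function.update X i
            (X i + latticeVec (L / m) (fun k => ((j k : ℕ) : ℤ))))) * Ψ.ψ X).re) *
            Real.cos (2 * Real.pi * (∑ k, ((q k : ℕ) : ℝ) * ((j k : ℕ) : ℝ)) / m)) / (m : ℝ) ^ 3)
    {f : L2T N} (hf : f ∈ maxFormGroundStates v N L) (hf1 : ‖f‖ = 1) (i : Fin N)
    (hGpos : ∀ r : EuclideanSpace ℝ (Fin 3), 0 < (⟪(τ[fun p : Fin N × Fin 3 =>
      (Pi.single i (toUnitTorus L r) : Fin N → UnitAddTorus (Fin 3)) p.1 p.2] f : L2T N), f⟫_ℂ).re)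
    (q : Fin 3 → Fin m) (hq : ∃ k, (q k : ℕ) ≠ 0) :
    0 ≤ (∑ j : Fin 3 → Fin m,
      Real.log ((⟪(τ[fun p : Fin N × Fin 3 =>
        (Pi.single i (toUnitTorus L (latticeVec (L / m) (fun k => ((j k : ℕ) : ℤ)))) :
          Fin N → UnitAddTorus (Fin 3)) p.1 p.2] f : L2T N), f⟫_ℂ).re) *
        Real.cos (2 * Real.pi * (∑ k, ((q k : ℕ) : ℝ) * ((j k : ℕ) : ℝ)) / m)) / (m : ℝ) ^ 3 := by
  obtain ⟨Φ, hΦE, hconv⟩ := exists_trialStates_tendsto_groundState hv hL hE hf hf1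
  -- the weights of the approximants converge to the weight of `f`
  have hnode := GridLevySignReduction.tendsto_re_cellCoherence hL Φ f hconv i
  have hw := GridLevySignReduction.tendsto_logWeight (Finset.univ : Finset (Fin 3 → Fin m))
    (a := fun n j => (∫ X in cellN N L, conj ((Φ n).ψ (Function.update X i
      (X i + latticeVec (L / m) (fun k => ((j k : ℕ) : ℤ))))) * (Φ n).ψ X).re)
    (b := fun j => (⟪(τ[fun p : Fin N × Fin 3 =>
      (Pi.single i (toUnitTorus L (latticeVec (L / m) (fun k => ((j k : ℕ) : ℤ)))) :
        Fin N → UnitAddTorus (Fin 3)) p.1 p.2] f : L2T N), f⟫_ℂ).re)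
    (fun j => Real.cos (2 * Real.pi * (∑ k, ((q k : ℕ) : ℝ) * ((j k : ℕ) : ℝ)) / m)) ((m : ℝ) ^ 3)
    (fun j => hGpos _) (fun j => hnode _)
  -- for every `ε > 0` the weight of `f` is `≥ -ε`
  refine le_of_forall_lt fun c hc => ?_
  obtain ⟨δ, hδ, hslack⟩ := hcrux (-c / 2) (by linarith)
  -- eventually `1/(k+1) ≤ δ`, so `Φ k` is a `δ`-near-minimiser
  have hev : ∀ᶠ k : ℕ in atTop, ENNReal.ofReal (1 / ((k : ℝ) + 1)) < δ := by
    have h0 : Tendsto (fun k : ℕ => ENNReal.ofReal (1 / ((k : ℝ) + 1))) atTop (𝓝 0) := by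
      have h2 := ENNReal.tendsto_ofReal (tendsto_one_div_add_atTop_nhds_zero_nat)
      rwa [ENNReal.ofReal_zero] at h2
    exact h0.eventually_lt_const hδ
  have hbound : ∀ᶠ k : ℕ in atTop, -(-c / 2) ≤ (∑ j : Fin 3 → Fin m,
      Real.log ((∫ X in cellN N L, conj ((Φ k).ψ (Function.update X i
        (X i + latticeVec (L / m) (fun k => ((j k : ℕ) : ℤ))))) * (Φ k).ψ X).re) *
        Real.cos (2 * Real.pi * (∑ k, ((q k : ℕ) : ℝ) * ((j k : ℕ) : ℝ)) / m)) / (m : ℝ) ^ 3 := by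
    filter_upwards [hev] with k hk
    exact hslack (Φ k) ((hΦE k).trans (add_le_add le_rfl hk.le)) i q hq
  have hge := ge_of_tendsto hw hbound
  linarith

end GridLevySignNecessity

/-- **Necessity of the registered sign stub**: the crux `GridInfDivCoherence` IMPLIES `stub_groundStateGridLevySign`
(its sign conjunct in exact ground-state form, verbatim the registered let-free signature). Proof: `η, ρ₀` from the
crux, `ρ₁` from Ruelle finiteness; at a large `N` apply `GridLevySignNecessity.logWeight_nonneg_of_slack` (unit
ground states are `L²` limits of near-minimising trial states by MaxFormApproximation; the weights converge).
[cite: ReedSimonIV1978, Thm XIII.64] -/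
theorem groundStateGridLevySign_of_gridInfDivCoherence :
    GridInfDivCoherence →
    ∀ v : ℝ → ℝ≥0∞, IsRepulsiveFiniteRange v → ∃ η : ℝ, 0 < η ∧ ∃ ρ₀ : ℝ, 0 < ρ₀ ∧
      ∀ ρ : ℝ, 0 < ρ → ρ < ρ₀ → ∀ᶠ N : ℕ in atTop,
        ∀ f : Lp ℂ 2 (volume : Measure (UnitAddTorus (Fin N × Fin 3))),
          f ∈ maxFormGroundStates v N (sideLength ρ N) → ‖f‖ = 1 → ∀ i : Fin N,
            (∀ r : EuclideanSpace ℝ (Fin 3), 0 < (⟪(Lp.compMeasurePreservingₗᵢ ℂ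
                (fun t : UnitAddTorus (Fin N × Fin 3) => t + fun p : Fin N × Fin 3 =>
                  (Pi.single i (toUnitTorus (sideLength ρ N) r) : Fin N → UnitAddTorus (Fin 3)) p.1 p.2)
                (measurePreserving_add_right volume _) f), f⟫_ℂ).re) →
            ∀ q : Fin 3 → Fin ⌊sideLength ρ N / η⌋₊, (∃ k, (q k : ℕ) ≠ 0) →
              0 ≤ (∑ j : Fin 3 → Fin ⌊sideLength ρ N / η⌋₊,
                Real.log ((⟪(Lp.compMeasurePreservingₗᵢ ℂ
                  (fun t : UnitAddTorus (Fin N × Fin 3) => t + fun p : Fin N × Fin 3 =>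
                    (Pi.single i (toUnitTorus (sideLength ρ N)
                      (latticeVec (sideLength ρ N / ⌊sideLength ρ N / η⌋₊) (fun k => ((j k : ℕ) : ℤ)))) :
                      Fin N → UnitAddTorus (Fin 3)) p.1 p.2)
                  (measurePreserving_add_right volume _) f), f⟫_ℂ).re) *
                  Real.cos (2 * Real.pi * (∑ k, ((q k : ℕ) : ℝ) * ((j k : ℕ) : ℝ)) / ⌊sideLength ρ N / η⌋₊)) /
                ((⌊sideLength ρ N / η⌋₊ : ℕ) : ℝ) ^ 3 := by
  intro hG v hv
  obtain ⟨η, hη, ρ₀, hρ₀, hcrux⟩ := hG v hv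
  obtain ⟨ρF, hρF, hfin⟩ :=
    Literature.Barriers.AtomisticToContinuum.BoseGas.exists_eventually_periodicGroundStateEnergy_lt_top hv
  refine ⟨η, hη, min ρ₀ ρF, lt_min hρ₀ hρF, fun ρ hρ hρlt => ?_⟩
  have hρ₀' : ρ < ρ₀ := hρlt.trans_le (min_le_left _ _)
  have hρF' : ρ < ρF := hρlt.trans_le (min_le_right _ _)
  filter_upwards [hcrux ρ hρ hρ₀', hfin ρ hρ hρF', (tendsto_sideLength_atTop hρ).eventually_gt_atTop 0]
    with N hN hEN hL
  intro f hf hf1 i hGpos q hq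
  refine GridLevySignNecessity.logWeight_nonneg_of_slack hv hL hEN.ne ⌊sideLength ρ N / η⌋₊ (fun ε hε => ?_)
    hf hf1 i hGpos q hq
  obtain ⟨δ, hδ, hslack⟩ := hN ε hε
  exact ⟨δ, hδ, fun Ψ hΨ i' q' hq' => (hslack Ψ hΨ i').2 q' hq'⟩

/-- **The crux is EQUIVALENT to the sign stub given ground-state coherence positivity.** If, for every repulsive
finite-range `v`, dilute and eventually in `N`, every unit maximal-form ground state has `re⟪τ_{i,u} f, f⟫ > 0` at
every single-particle torus shift (the line's other registered residue), then
`GridInfDivCoherence ↔ stub_groundStateGridLevySign`: `→` is `groundStateGridLevySign_of_gridInfDivCoherence`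
(positivity not even needed); `←` is the skeleton's assembly through the landed reductions
`stub_coherencePos_of_groundStates` (p161669) and `stub_gridLevySign_of_groundStates` (p162041).
[cite: ReedSimonIV1978, Thm XIII.64] -/
theorem gridInfDivCoherence_iff_groundStateGridLevySign_of_pos
    (hPos : ∀ v : ℝ → ℝ≥0∞, IsRepulsiveFiniteRange v →
      ∃ ρ₀ : ℝ, 0 < ρ₀ ∧ ∀ ρ : ℝ, 0 < ρ → ρ < ρ₀ → ∀ᶠ N : ℕ in atTop,
        ∀ f : Lp ℂ 2 (volume : Measure (UnitAddTorus (Fin N × Fin 3))),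
          f ∈ maxFormGroundStates v N (sideLength ρ N) → ‖f‖ = 1 →
            ∀ (i : Fin N) (u : UnitAddTorus (Fin 3)),
              0 < (⟪(Lp.compMeasurePreservingₗᵢ ℂ
                  (fun t : UnitAddTorus (Fin N × Fin 3) => t + fun p : Fin N × Fin 3 =>
                    (Pi.single i u : Fin N → UnitAddTorus (Fin 3)) p.1 p.2)
                  (measurePreserving_add_right volume _) f), f⟫_ℂ).re) :
    GridInfDivCoherence ↔
    (∀ v : ℝ → ℝ≥0∞, IsRepulsiveFiniteRange v → ∃ η : ℝ, 0 < η ∧ ∃ ρ₀ : ℝ, 0 < ρ₀ ∧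
      ∀ ρ : ℝ, 0 < ρ → ρ < ρ₀ → ∀ᶠ N : ℕ in atTop,
        ∀ f : Lp ℂ 2 (volume : Measure (UnitAddTorus (Fin N × Fin 3))),
          f ∈ maxFormGroundStates v N (sideLength ρ N) → ‖f‖ = 1 → ∀ i : Fin N,
            (∀ r : EuclideanSpace ℝ (Fin 3), 0 < (⟪(Lp.compMeasurePreservingₗᵢ ℂ
                (fun t : UnitAddTorus (Fin N × Fin 3) => t + fun p : Fin N × Fin 3 =>
                  (Pi.single i (toUnitTorus (sideLength ρ N) r) : Fin N → UnitAddTorus (Fin 3)) p.1 p.2)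
                (measurePreserving_add_right volume _) f), f⟫_ℂ).re) →
            ∀ q : Fin 3 → Fin ⌊sideLength ρ N / η⌋₊, (∃ k, (q k : ℕ) ≠ 0) →
              0 ≤ (∑ j : Fin 3 → Fin ⌊sideLength ρ N / η⌋₊,
                Real.log ((⟪(Lp.compMeasurePreservingₗᵢ ℂ
                  (fun t : UnitAddTorus (Fin N × Fin 3) => t + fun p : Fin N × Fin 3 =>
                    (Pi.single i (toUnitTorus (sideLength ρ N)
                      (latticeVec (sideLength ρ N / ⌊sideLength ρ N / η⌋₊) (fun k => ((j k : ℕ) : ℤ)))) :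
                      Fin N → UnitAddTorus (Fin 3)) p.1 p.2)
                  (measurePreserving_add_right volume _) f), f⟫_ℂ).re) *
                  Real.cos (2 * Real.pi * (∑ k, ((q k : ℕ) : ℝ) * ((j k : ℕ) : ℝ)) / ⌊sideLength ρ N / η⌋₊)) /
                ((⌊sideLength ρ N / η⌋₊ : ℕ) : ℝ) ^ 3) := by
  refine ⟨groundStateGridLevySign_of_gridInfDivCoherence, fun hSign v hv => ?_⟩
  obtain ⟨ρ₁, hρ₁, hP⟩ := stub_coherencePos_of_groundStates hPos v hv
  obtain ⟨η, hη, ρ₂, hρ₂, hS⟩ := stub_gridLevySign_of_groundStates hPos hSign v hv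
  refine ⟨η, hη, min ρ₁ ρ₂, lt_min hρ₁ hρ₂, fun ρ hρpos hρlt => ?_⟩
  filter_upwards [hP ρ hρpos (hρlt.trans_le (min_le_left _ _)),
    hS ρ hρpos (hρlt.trans_le (min_le_right _ _))] with N hPN hSN
  intro ε hε
  obtain ⟨δ₁, hδ₁, h₁⟩ := hPN
  obtain ⟨δ₂, hδ₂, h₂⟩ := hSN ε hε
  refine ⟨min δ₁ δ₂, lt_min hδ₁ hδ₂, fun Ψ hΨle i => ?_⟩
  have hΨ₁ : periodicEnergy v Ψ ≤ periodicGroundStateEnergy v N (sideLength ρ N) + δ₁ :=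
    hΨle.trans (add_le_add le_rfl (min_le_left _ _))
  have hΨ₂ : periodicEnergy v Ψ ≤ periodicGroundStateEnergy v N (sideLength ρ N) + δ₂ :=
    hΨle.trans (add_le_add le_rfl (min_le_right _ _))
  exact ⟨fun r => h₁ Ψ hΨ₁ i r, fun q hq => h₂ Ψ hΨ₂ i q hq⟩

end Summit.AtomisticToContinuum.BoseEinsteinCondensation.Theorems

end
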